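import Summits.FinalStateConjecture.FinalStateConjecture.Theorems.PhotonSphereChannelsExteriorEnergyRW

/-!
# Route PhotonSphereChannels — conservation of the total energy of FINITE-ENERGY (not compactly
# supported) solutions of `ψ_tt − ψ_xx + Vψ = 0`, `V ≥ 0`, and the zero-energy rigidity

Helper file for stub `stub_futureSilentWavesVanish` (L) of line `isolated-kerr-connected-hull`
(crux stmt-FinalStateConjecture-14075), over the Literature vocabulary
`ReggeWheeler.{energyDensity, IsSolution, totalEnergy, linePotential, IsTortoiseRadius, IsRWSolution}`.
The tree has energy conservation only for compactly supported data (`RW.totalEnergy_eq`); the stub's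
solutions are merely of finite energy at `t = 0`.  Here:

* `RW.energyDensity_eq_fderiv`, `RW.IsSolution.fderiv_eq`, `RW.continuous_energyDensity₂` — the
  dictionary to the Fréchet calculus of `…Theorems.WaveEnergy`;
* `RW.setLIntegral_Ioi_energy_le_totalEnergy` — for ANY two times, the energy on a right half-line
  at one time is at most the total energy at the other (domain of dependence, both directions);
* `RW.totalEnergy_eq_totalEnergy` — **the total energy `∫⁻ e[ψ](t,·) ∈ [0,∞]` of a global `C²`
  solution (`V ≥ 0` differentiable) is independent of `t`** (no finiteness or support hypothesis;
  monotone exhaustion by half-lines);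
* `RW.eq_zero_of_totalEnergy_eq_zero` — (H1 of the stub's route) if `V > 0` everywhere and the total
  energy vanishes at one time, the solution vanishes identically;
* the Regge–Wheeler instances `RW.totalEnergy_eq_totalEnergy_rw`, `RW.eq_zero_of_totalEnergy_eq_zero_rw`.

No new definitions; standard material [folklore].
-/

namespace Summit.FinalStateConjecture.FinalStateConjecture.Theorems

-- the tree's namespace `Summit.FinalStateConjecture.FinalStateConjecture.Theorems` repeats a component
-- by design (statement file `Summits/FinalStateConjecture/FinalStateConjecture/…`), as in every landed
-- `…Theorems` file of this route
set_option linter.dupNamespace false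

open MeasureTheory Set Filter Topology
open Literature.Geometry.Lorentzian Literature.Geometry.Lorentzian.ReggeWheeler

noncomputable section

namespace RW

section General

variable {V : ℝ → ℝ} {ψ : ℝ → ℝ → ℝ}

/-- Dictionary: the Literature energy density of a `C²` function is the Fréchet-partial expression
used by the `WaveEnergy` files. [folklore] -/
theorem energyDensity_eq_fderiv (hψ : ContDiff ℝ 2 (Function.uncurry ψ)) (t x : ℝ) :
    energyDensity V ψ t x = (fderiv ℝ (Function.uncurry ψ) (t, x) (1, 0)) ^ 2
      + (fderiv ℝ (Function.uncurry ψ) (t, x) (0, 1)) ^ 2 + V x * Function.uncurry ψ (t, x) ^ 2 := by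
  unfold energyDensity
  rw [WaveEnergy.deriv_slice_fst_eq hψ, WaveEnergy.deriv_slice_snd_eq hψ]
  rfl

/-- Dictionary, in the `he`-hypothesis format of the `WaveEnergy` files
(`e := fun z ↦ energyDensity V ψ z.1 z.2`). [folklore] -/
theorem energyDensity_he (hψ : ContDiff ℝ 2 (Function.uncurry ψ)) :
    ∀ z : ℝ × ℝ, (fun z : ℝ × ℝ ↦ energyDensity V ψ z.1 z.2) z
      = (fderiv ℝ (Function.uncurry ψ) z (1, 0)) ^ 2 + (fderiv ℝ (Function.uncurry ψ) z (0, 1)) ^ 2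
        + V z.2 * Function.uncurry ψ z ^ 2 :=
  fun z ↦ energyDensity_eq_fderiv hψ z.1 z.2

/-- Dictionary: a global solution solves the equation in Fréchet form (`hsol` of the `WaveEnergy`
files). [folklore] -/
theorem IsSolution.fderiv_eq (hψ : IsSolution V ψ) :
    ∀ z : ℝ × ℝ, fderiv ℝ (fderiv ℝ (Function.uncurry ψ)) z (1, 0) (1, 0)
      - fderiv ℝ (fderiv ℝ (Function.uncurry ψ)) z (0, 1) (0, 1) + V z.2 * Function.uncurry ψ z = 0 := by
  rintro ⟨t, x⟩
  rw [← WaveEnergy.iteratedDeriv_two_slice_fst_eq hψ.1, ← WaveEnergy.iteratedDeriv_two_slice_snd_eq hψ.1]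
  exact hψ.2 (t, x)

/-- The energy density of a `C²` function is jointly continuous in `(t, x)` (`V` differentiable).
[folklore] -/
theorem continuous_energyDensity₂ (hV : Differentiable ℝ V) (hψ : ContDiff ℝ 2 (Function.uncurry ψ)) :
    Continuous (fun z : ℝ × ℝ ↦ energyDensity V ψ z.1 z.2) :=
  WaveEnergy.continuous_energyDensity hψ hV (energyDensity_he hψ)

/-- The energy density at a fixed time is continuous in `x`. [folklore] -/
theorem continuous_energyDensity_slice (hV : Differentiable ℝ V)
    (hψ : ContDiff ℝ 2 (Function.uncurry ψ)) (t : ℝ) :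
    Continuous (fun x ↦ energyDensity V ψ t x) :=
  (continuous_energyDensity₂ hV hψ).comp (Continuous.prodMk_right t)

/-- The total energy is the supremum of the energies on the right half-lines `(−n, ∞)`. [folklore] -/
theorem totalEnergy_eq_iSup_Ioi (V : ℝ → ℝ) (ψ : ℝ → ℝ → ℝ) (t : ℝ) :
    totalEnergy V ψ t = ⨆ n : ℕ, ∫⁻ x in Ioi (-(n : ℝ)), ENNReal.ofReal (energyDensity V ψ t x) := by
  have hdir : Directed (· ⊆ ·) (fun n : ℕ ↦ Ioi (-(n : ℝ))) := by
    refine Monotone.directed_le fun i j hij ↦ Ioi_subset_Ioi ?_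
    exact neg_le_neg (Nat.cast_le.mpr hij)
  have hU : (⋃ n : ℕ, Ioi (-(n : ℝ))) = univ := by
    refine eq_univ_of_forall fun x ↦ ?_
    obtain ⟨n, hn⟩ := exists_nat_gt (-x)
    exact mem_iUnion.2 ⟨n, by simp only [mem_Ioi]; linarith⟩
  unfold totalEnergy
  rw [← setLIntegral_univ, ← hU, setLIntegral_iUnion_of_directed _ hdir]

/-- **Half-line energies are bounded by the total energy at any other time.** For a global `C²`
solution (`V ≥ 0` differentiable) and ANY two times `t₁, t₂`, the energy on `(c, ∞)` at time `t₁`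
is at most the total energy at time `t₂` (future or past domain of dependence of a half-line).
[folklore] -/
theorem setLIntegral_Ioi_energy_le_totalEnergy (hV : Differentiable ℝ V) (hV0 : ∀ x, 0 ≤ V x)
    (hψ : IsSolution V ψ) (c t₁ t₂ : ℝ) :
    ∫⁻ x in Ioi c, ENNReal.ofReal (energyDensity V ψ t₁ x) ≤ totalEnergy V ψ t₂ := by
  have he := energyDensity_he (V := V) hψ.1
  have hsol := IsSolution.fderiv_eq hψ
  rcases le_total t₁ t₂ with h | h
  · -- forward: the energy on `(c, ∞)` at `t₁` is at most the energy on `(c − (t₂ − t₁), ∞)` at `t₂`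
    have key := WaveEnergy.lintegral_Ioi_le_expanding hψ.1 hV hV0 hsol he c h
    exact key.trans (setLIntegral_le_lintegral _ _)
  · -- backward: the energy on `(c, ∞) = (c' + (t₁ − t₂), ∞)` at `t₁` is at most that on `(c', ∞)` at `t₂`
    have key := WaveEnergy.lintegral_Ioi_shrinking_le hψ.1 hV hV0 hsol he (c - (t₁ - t₂)) h
    have e1 : c - (t₁ - t₂) + (t₁ - t₂) = c := by ring
    rw [e1] at key
    exact key.trans (setLIntegral_le_lintegral _ _)

/-- The total energy at one time is at most the total energy at any other time. [folklore] -/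
theorem totalEnergy_le_totalEnergy (hV : Differentiable ℝ V) (hV0 : ∀ x, 0 ≤ V x)
    (hψ : IsSolution V ψ) (t₁ t₂ : ℝ) : totalEnergy V ψ t₁ ≤ totalEnergy V ψ t₂ := by
  rw [totalEnergy_eq_iSup_Ioi V ψ t₁]
  exact iSup_le fun n ↦ setLIntegral_Ioi_energy_le_totalEnergy hV hV0 hψ _ t₁ t₂

/-- **Conservation of the total energy** of a global `C²` solution of `ψ_tt − ψ_xx + Vψ = 0`,
`V ≥ 0` differentiable: `∫⁻ e[ψ](t₁, ·) = ∫⁻ e[ψ](t₂, ·)` in `[0, ∞]`, with no support or finiteness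
hypothesis. [folklore] -/
theorem totalEnergy_eq_totalEnergy (hV : Differentiable ℝ V) (hV0 : ∀ x, 0 ≤ V x)
    (hψ : IsSolution V ψ) (t₁ t₂ : ℝ) : totalEnergy V ψ t₁ = totalEnergy V ψ t₂ :=
  le_antisymm (totalEnergy_le_totalEnergy hV hV0 hψ t₁ t₂) (totalEnergy_le_totalEnergy hV hV0 hψ t₂ t₁)

/-- In particular finiteness of the total energy propagates from `t = 0` to all times. [folklore] -/
theorem totalEnergy_lt_top_of_zero (hV : Differentiable ℝ V) (hV0 : ∀ x, 0 ≤ V x)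
    (hψ : IsSolution V ψ) (h0 : totalEnergy V ψ 0 < ⊤) (t : ℝ) : totalEnergy V ψ t < ⊤ := by
  rwa [totalEnergy_eq_totalEnergy hV hV0 hψ t 0]

/-- Zero total energy at time `t` forces the energy density to vanish on the whole slice
(continuity of the density). [folklore] -/
theorem energyDensity_eq_zero_of_totalEnergy_eq_zero (hV : Differentiable ℝ V) (hV0 : ∀ x, 0 ≤ V x)
    (hψ : ContDiff ℝ 2 (Function.uncurry ψ)) {t : ℝ} (h0 : totalEnergy V ψ t = 0) (x : ℝ) :
    energyDensity V ψ t x = 0 := by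
  have hc := continuous_energyDensity_slice (V := V) hV hψ t
  have hc' : Continuous fun y ↦ ENNReal.ofReal (energyDensity V ψ t y) :=
    ENNReal.continuous_ofReal.comp hc
  unfold totalEnergy at h0
  rw [lintegral_eq_zero_iff hc'.measurable] at h0
  have hfun := (Continuous.ae_eq_iff_eq volume hc' continuous_const).1 h0
  have hx : ENNReal.ofReal (energyDensity V ψ t x) = 0 := congr_fun hfun x
  rw [ENNReal.ofReal_eq_zero] at hx
  exact le_antisymm hx (energyDensity_nonneg ψ t (hV0 x))

/-- **Zero-energy rigidity (H1).** For `V > 0` everywhere (differentiable) a global `C²` solution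
whose total energy vanishes at ONE time vanishes identically (`Vψ² ≤ e = 0` on that slice, and the
total energy is conserved). [folklore] -/
theorem eq_zero_of_totalEnergy_eq_zero (hV : Differentiable ℝ V) (hVpos : ∀ x, 0 < V x)
    (hψ : IsSolution V ψ) {t₀ : ℝ} (h0 : totalEnergy V ψ t₀ = 0) (t x : ℝ) : ψ t x = 0 := by
  have hV0 : ∀ x, 0 ≤ V x := fun x ↦ (hVpos x).le
  have ht : totalEnergy V ψ t = 0 := by rw [totalEnergy_eq_totalEnergy hV hV0 hψ t t₀, h0]
  have he := energyDensity_eq_zero_of_totalEnergy_eq_zero hV hV0 hψ.1 ht x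
  unfold energyDensity at he
  have h3 : V x * ψ t x ^ 2 = 0 := by
    nlinarith [sq_nonneg (deriv (fun τ ↦ ψ τ x) t), sq_nonneg (deriv (ψ t) x),
      mul_nonneg (hV0 x) (sq_nonneg (ψ t x))]
  rcases mul_eq_zero.1 h3 with h | h
  · exact absurd h (hVpos x).ne'
  · exact pow_eq_zero_iff (n := 2) (by norm_num) |>.1 h

end General

/-! ### Regge–Wheeler instances -/

section ReggeWheelerInstance

variable {M : ℝ} {r : ℝ → ℝ} {xc : ℝ} {s ℓ : ℕ} {ψ : ℝ → ℝ → ℝ}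

/-- Conservation of the total energy of ANY global `C²` Regge–Wheeler solution (tortoise radius
function, `s ≤ ℓ`). [folklore] -/
theorem totalEnergy_eq_totalEnergy_rw (hr : IsTortoiseRadius M r xc) (hsℓ : s ≤ ℓ)
    (hψ : IsRWSolution M s ℓ r ψ) (t₁ t₂ : ℝ) :
    totalEnergy (linePotential M s ℓ r) ψ t₁ = totalEnergy (linePotential M s ℓ r) ψ t₂ :=
  totalEnergy_eq_totalEnergy (differentiable_linePotential hr s ℓ)
    (fun x ↦ (linePotential_pos hr hsℓ x).le) hψ t₁ t₂

/-- **H1 for Regge–Wheeler**: a global `C²` Regge–Wheeler solution (tortoise radius function,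
`s ≤ ℓ`) with zero total energy at one time vanishes identically. [folklore] -/
theorem eq_zero_of_totalEnergy_eq_zero_rw (hr : IsTortoiseRadius M r xc) (hsℓ : s ≤ ℓ)
    (hψ : IsRWSolution M s ℓ r ψ) {t₀ : ℝ} (h0 : totalEnergy (linePotential M s ℓ r) ψ t₀ = 0)
    (t x : ℝ) : ψ t x = 0 :=
  eq_zero_of_totalEnergy_eq_zero (differentiable_linePotential hr s ℓ) (linePotential_pos hr hsℓ)
    hψ h0 t x

/-- **Registered sub-goal `stub_futureSilentWavesVanish_H1` of stub L** (crux
stmt-FinalStateConjecture-14075, line `isolated-kerr-connected-hull`): for every global `C²`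
Regge–Wheeler solution along a tortoise radius function (`s ≤ ℓ`) the total energy is conserved, and
zero total energy at one time forces `ψ ≡ 0`. [folklore] -/
theorem stub_futureSilentWavesVanish_H1 :
    ∀ (M : ℝ) (r : ℝ → ℝ) (xc : ℝ), ReggeWheeler.IsTortoiseRadius M r xc →
      ∀ (s ℓ : ℕ), s ≤ ℓ → ∀ ψ : ℝ → ℝ → ℝ, ReggeWheeler.IsRWSolution M s ℓ r ψ →
        (∀ t₁ t₂ : ℝ, ReggeWheeler.totalEnergy (ReggeWheeler.linePotential M s ℓ r) ψ t₁
          = ReggeWheeler.totalEnergy (ReggeWheeler.linePotential M s ℓ r) ψ t₂) ∧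
        (∀ t₀ : ℝ, ReggeWheeler.totalEnergy (ReggeWheeler.linePotential M s ℓ r) ψ t₀ = 0 →
          ∀ t x, ψ t x = 0) :=
  fun _ _ _ hr _ _ hsℓ _ hψ ↦ ⟨totalEnergy_eq_totalEnergy_rw hr hsℓ hψ,
    fun _ h0 ↦ eq_zero_of_totalEnergy_eq_zero_rw hr hsℓ hψ h0⟩

end ReggeWheelerInstance

end RW

end

end Summit.FinalStateConjecture.FinalStateConjecture.Theorems
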